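import Mathlib
import Literature.Computability.QuantumComplexity.GaussianRank
import Summits.QuantumAdvantage.QuantumAdvantage.Theses.SpinorFlattening
import Summits.QuantumAdvantage.QuantumAdvantage.Theorems.GaussRankTwoCopies.Negative.TightFour

/-!
# Skeleton line `cayley-bilinear-prolongation` for crux `SpinorFlattening.GaussRankTwoCopies`
(stmt-QuantumAdvantage-1248: `χ_G(M ⊗ M) ≥ 4` — two copies of the matchgate magic state are not a
linear combination of three fermionic Gaussian states)

crux-plan seat `planner-cruxplan-stmt-QuantumAdvantage-1248-cayley-bilinear-prol-0`, 2026-08-16.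
Idea card `Cruxes/GaussRankTwoCopies/Ideas/cayley-bilinear-prolongation.md` (ideator 1, round 1),
sharpened by TRIAGE-r1-1/2/3.  Line card: `Lines/cayley-bilinear-prolongation.md`.

THE LINE ("square the state, do not flatten it").  Let `B(φ,ψ) = φᵀ C ψ` be the `Spin(16)`-invariant
bilinear form on 8-qubit vectors (`C = X⊗Y⊗X⊗Y⊗X⊗Y⊗X⊗Y`; every Jordan–Wigner Majorana is
`B`-self-adjoint) and `β(φ,ψ)_S = B(φ, c_S ψ)` Cartan's bilinear covariants (`c_S` = ordered product
of the Majoranas labelled by `S ⊆ Fin 16`, label `l ↦ (wire l/2, X if l even, Y if l odd)`).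
1. PROLONGATION (`stub_prolongation`): pure spinors are isotropic below the top degree
   (`β(g,g)_S = 0` for `|S| < 8`, Cartan 1938 / Chevalley 1954 III), so if `M⊗M = Σ_{i<3} aᵢgᵢ` then
   for every `|S| < 8` only the SIX ordered PAIR TERMS survive: `β(M⊗M,M⊗M)_S = Σ_{i≠j} aᵢaⱼ β(gᵢ,gⱼ)_S`.
2. PAIR STRUCTURE (`stub_pairStructure`): for two Gaussian states the pair data
   `N = B(g,g')`, `G_{xy} = B(g, c_x c_y g')` satisfy: `N` symmetric, `G` skew in `(x,y)` and in
   `(g,g')`, the INVOLUTION identity `G² = N²·1` (the relative covariance of a transverse Lagrangian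
   pair is the reflection `π_L − π_{L'}`; degenerate pairs give `G² = 0 = N²`), and WICK in the
   transversality-free form `N·β(g,g')_S = Pf(G[S])` for `|S| = 4`.
3. TRIPLE STRUCTURE (`stub_tripleStructure`): for a pairwise transverse triple the three involutions
   `J_{ij} = G_{ij}/N_{ij} = π_{Lᵢ} − π_{Lⱼ}` share eigenspaces: `(J_{ij} − 1)(J_{ik} + 1) = 0` — the
   provenance constraint "ONE Lagrangian triple" of the card's `C⁺`.
4. DEGENERATE PAIRS (`stub_isotropicPairFree`): a decomposition in which some pair is
   `B`-orthogonal (`B(gᵢ,gⱼ) = 0 ⇔ Lᵢ ∩ Lⱼ ≠ 0`, Chevalley) is impossible — this is Case D of the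
   sibling line `lagrangian-triple-rigidity` (Ideator3Notes §6.4, `NonTransversePairFree`), imported
   here as a declared shared stub: the Cayley mechanism below needs `N_{ij} ≠ 0`.
5. THE TARGET (`stub_magicQuartic`, finite computation): `β₀(M⊗M,M⊗M) = 1` and `β₄(M⊗M,M⊗M)` is
   the explicit double Cayley table `cayleyTable` (14 + 14 in-block Hamming quadruples, `±1`, no
   mixed component) — the only information about `M` the kill consumes.
6. THE KILL (`stub_threeSquaresFree`, load-bearing, OPEN): there are no weights and no three
   "Lagrangian-pair" quartics — `Q_p = N_p⁻¹·Pf₄(G_p)` with `G_p` skew, `G_p² = N_p²·1`, `N_p ≠ 0`,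
   sharing eigenspaces as in step 3 — with `Σ_{i≠j} aᵢaⱼN_{ij} = β₀(M⊗M,M⊗M)` (`= 1`) and `Σ_{i≠j} aᵢaⱼ Q_{ij}(S) = β₄(M⊗M,M⊗M)_S` for all
   `|S| = 4`.  The right-hand side is the DOUBLE CAYLEY 4-FORM `Φ_A ⊕ Φ_B` (14 + 14 in-block Hamming
   quadruples, values `±1`, no mixed component; stabiliser `spin(7) ⊕ spin(7)`), so this is the
   "three-squares identity" of the card with the involution constraint retained (triage r1-2 (a):
   this `C⁺` is STRONGER than the crux — it drops `β₈`; triage r1-3: attack it through the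
   `(3,1)`/`(1,3)` block equations = NET INJECTIVITY, then `(2,2)` is absurd because the three
   `Λ²V_A`-parts of a 3-square representation of the ∧-rank-3 Cayley form are independent).
`twoCopies_of_stubs` is the kernel-checked composition (hypotheses = the six stub statements; case split on
an isotropic pair) and `GaussRankTwoCopies_of` applies it to the six stubs BY NAME, concluding the crux decl.

Disproof.lean (cdisprove gen 1) obligations: §1 `false_without_gaussianity` /
`false_without_linearIndependence` are honoured at `stub_prolongation` (isotropy IS purity: for the
non-Gaussian `M⊗M`, `β₀ = 1 ≠ 0`) and at `stub_pairStructure` (Wick needs the full Lagrangian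
annihilator); §2 `not_twoCopiesBound_four` / landed `Negative.TightFour.gaussRankTwoCopies_tight_four`
(imported above): with FOUR terms the identity of step 4 has twelve ordered pair terms and IS solvable
(the Fock corners), so no stub is an instance it refutes — every stub is about exactly three terms or
about pairs; §4(6b) "a proof must use the odd⊗odd data with the chirality coupling": the pair
covariances `G_{ij} ∈ Λ²ℂ¹⁶` encode the full Lagrangian pair (both chiralities), not an E-sector
polynomial; §5 parity: built in (odd/even pairs have `N = 0`, `G = 0` and fall under step 3).

Nothing below is claimed as a theorem of the tree except `twoCopies_of_stubs` / `cov_empty` (no `sorry`)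
and the wiring `GaussRankTwoCopies_of` (sorry only through the named stubs); the six `stub_*` are the
registered stubs.
-/

noncomputable section

set_option linter.dupNamespace false

namespace Summit.QuantumAdvantage.QuantumAdvantage.Cruxes.GaussRankTwoCopies.CayleyBilinearProlongation

open Literature.Computability.Cryptography Literature.Computability.QuantumComplexity Matrix
open scoped BigOperators

/-! ## Vocabulary (transparent abbreviations over `GaussianRank.lean`) -/

/-- The 16 Jordan–Wigner Majoranas of 8 qubits with a LINEAR label `l : Fin 16`:
`maj16 l = majorana 8 (l / 2) (l odd)`, i.e. `c₀ = c_{0,X}, c₁ = c_{0,Y}, c₂ = c_{1,X}, …`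
(Cudby–Strelchuk's `c_{2k-1} = Z^{⊗(k-1)}X_k`, `c_{2k} = Z^{⊗(k-1)}Y_k`). Block A = labels `0…7`
(wires `0…3`), block B = labels `8…15` (wires `4…7`). -/
def maj16 (l : Fin 16) : Matrix (QReg 8) (QReg 8) ℂ :=
  majorana 8 ⟨l.val / 2, by omega⟩ (decide (l.val % 2 = 1))

/-- The ordered Majorana monomial `c_S = c_{s₁} c_{s₂} ⋯ c_{s_k}` (`s₁ < s₂ < ⋯ < s_k`). -/
def majProd (S : Finset (Fin 16)) : Matrix (QReg 8) (QReg 8) ℂ :=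
  ((S.sort (· ≤ ·)).map maj16).prod

/-- Charge conjugation `C = X ⊗ Y ⊗ X ⊗ Y ⊗ X ⊗ Y ⊗ X ⊗ Y` (`X` on even wires, `Y` on odd wires):
`C c_p C⁻¹ = c_pᵀ` for all 16 Majoranas, `C² = 1`, `Cᵀ = C` (8 ≡ 0 mod 4). -/
def chargeConj : Matrix (QReg 8) (QReg 8) ℂ :=
  pauliString (fun i : Fin 8 => if i.val % 2 = 0 then Pauli.X else Pauli.Y)

/-- The `Spin(16,ℂ)`-invariant symmetric bilinear form `B(φ,ψ) = φᵀ C ψ` on `(ℂ²)^{⊗8}`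
(no complex conjugation). -/
def bilin (φ ψ : QReg 8 → ℂ) : ℂ := φ ⬝ᵥ (chargeConj *ᵥ ψ)

/-- Cartan's bilinear covariant `β(φ,ψ)_S = B(φ, c_S ψ)` (degree `|S|`). -/
def cov (φ ψ : QReg 8 → ℂ) (S : Finset (Fin 16)) : ℂ := bilin φ (majProd S *ᵥ ψ)

/-- Pair covariance matrix of two vectors: `G_{xy} = B(g, c_x c_y g')` for `x ≠ y`, `0` on the
diagonal (for a transverse Gaussian pair, `G = N · J` with `J = π_L − π_{L'}`). -/
def pairCov (g g' : QReg 8 → ℂ) : Matrix (Fin 16) (Fin 16) ℂ :=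
  Matrix.of fun x y => if x = y then 0 else bilin g ((maj16 x * maj16 y) *ᵥ g')

/-- The `4 × 4` Pfaffian of the principal minor of `F` on `S = {p < q < r < s}`
(`F_{pq}F_{rs} − F_{pr}F_{qs} + F_{ps}F_{qr}`), and `0` if `|S| ≠ 4`: the coefficient of `e_S` in
`(F ∧ F)/2`. -/
def pf4 (F : Matrix (Fin 16) (Fin 16) ℂ) (S : Finset (Fin 16)) : ℂ :=
  match S.sort (· ≤ ·) with
  | [p, q, r, s] => F p q * F r s - F p r * F q s + F p s * F q r
  | _ => 0

/-- Bookkeeping (proved): the degree-0 covariant is the bilinear form itself. -/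
theorem cov_empty (φ ψ : QReg 8 → ℂ) : cov φ ψ ∅ = bilin φ ψ := by
  simp [cov, majProd]

/-- Supports of the DOUBLE CAYLEY 4-FORM with value `+1`: `XXXX` and `YYYY` of each block
(labels `l = 2·wire + (0 for X, 1 for Y)`). Computed in these exact conventions by kit j010918 (T1). -/
def cayleyPlus : Finset (Finset (Fin 16)) :=
  { {0, 2, 4, 6}, {1, 3, 5, 7}, {8, 10, 12, 14}, {9, 11, 13, 15} }

/-- Supports of the double Cayley 4-form with value `−1`: per block, the six `(XY)_j(XY)_k` words and
the six even-weight mixed words `XXYY, XYXY, XYYX, YXXY, YXYX, YYXX` (12 + 12). kit j010918 (T1). -/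
def cayleyMinus : Finset (Finset (Fin 16)) :=
  { {0, 1, 2, 3}, {0, 1, 4, 5}, {0, 1, 6, 7}, {0, 2, 5, 7}, {0, 3, 4, 7}, {0, 3, 5, 6},
    {1, 2, 4, 7}, {1, 2, 5, 6}, {1, 3, 4, 6}, {2, 3, 4, 5}, {2, 3, 6, 7}, {4, 5, 6, 7},
    {8, 9, 10, 11}, {8, 9, 12, 13}, {8, 9, 14, 15}, {8, 10, 13, 15}, {8, 11, 12, 15}, {8, 11, 13, 14},
    {9, 10, 12, 15}, {9, 10, 13, 14}, {9, 11, 12, 14}, {10, 11, 12, 13}, {10, 11, 14, 15},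
    {12, 13, 14, 15} }

/-- The double Cayley 4-form `Φ_A ⊕ Φ_B` as a table on 4-subsets of the 16 Majorana labels:
`S ↦ β₄(M⊗M, M⊗M)_S = ⟨M⊗M| c_S |M⊗M⟩` — `±1` on the 14 + 14 in-block Hamming quadruples (the
degree-4 stabilisers `−Z_jZ_k`, `∓(XY-words)` of each GHZ₄ block), `0` on all 1792 other quadruples
(in particular on every MIXED quadruple: zero covariance of GHZ₄). Stabiliser in `gl(8) ⊕ gl(8)`:
`spin(7) ⊕ spin(7)` (kit j008520 Q4). -/
def cayleyTable (S : Finset (Fin 16)) : ℂ :=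
  if S ∈ cayleyPlus then 1 else if S ∈ cayleyMinus then -1 else 0

/-! ## The six registered stubs -/

/-- **STUB 1 — PROLONGATION (Cartan isotropy of pure spinors).** For Gaussian `g₀,g₁,g₂` and any
coefficients, the covariant of `w = Σ aᵢgᵢ` with itself has NO diagonal terms below the top
degree: `β(w,w)_S = Σ_{i≠j} aᵢaⱼ β(gᵢ,gⱼ)_S` for `|S| < 8`. Content = bilinearity + Cartan's theorem
`β(g,g)_S = 0` (`|S| < 8`) for every pure spinor of `Spin(16)` of either parity (the isotropy that
CHARACTERISES purity; elementary proof from the annihilator Lagrangian `L`: pick `l'ⱼ` dual to a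
basis `lⱼ` of `L`, normal-order `c_S g` into words `c(l'_J) g`, `|J| ≤ |S| < 8`, and for `i ∉ J`
use `2B(g, c(l'_J)g) = B(g,(c(lᵢ)c(l'ᵢ)+c(l'ᵢ)c(lᵢ))c(l'_J)g) = B(c(lᵢ)g, …) + B(g, c(l'ᵢ)c(l'_J)c(lᵢ)g)·(±1) = 0`).
TRUE (classical: É. Cartan 1938; Chevalley 1954 ch. III; kit j008520 Q1 / j010601 CI to 1e-16 in
these conventions). Size M. Honours Disproof §1: this is exactly where Gaussianity of EVERY term is
consumed (`β₀(M⊗M, M⊗M) = 1 ≠ 0`). -/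
theorem stub_prolongation :
    ∀ (a : Fin 3 → ℂ) (g : Fin 3 → QReg (2 * 4) → ℂ), (∀ i, IsGaussian (g i)) →
      ∀ S : Finset (Fin 16), S.card < 8 →
        cov (∑ i, a i • g i) (∑ i, a i • g i) S =
          ∑ i, ∑ j, if i = j then 0 else a i * a j * cov (g i) (g j) S := by
  sorry

/-- **STUB 2 — PAIR STRUCTURE (invariance of `B`, Wick, involution).** For two Gaussian states
`g, g'` on 8 qubits, with `N = B(g,g')` and `G = pairCov g g'`:
(i) `B(g',g) = N` (`Cᵀ = C`); (ii) `pairCov g' g = −G` and `Gᵀ = −G` (Majoranas are `B`-self-adjoint,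
`C c_p = c_pᵀ C`, plus anticommutation); (iii) INVOLUTION `G·G = N²·1` (transverse pair: `G = N·J`,
`J = π_L − π_{L'}`, `J² = 1`; degenerate pair `dim(L∩L') = d > 0`: `N = 0` and `G = 0` (`d ≥ 3` or
odd) or `G ∝ d₁d₂ᵀ − d₂d₁ᵀ` with `d₁,d₂` isotropic orthogonal (`d = 2`), square zero);
(iv) WICK, transversality-free: `N · B(g, c_S g') = Pf(G[S])` for `|S| = 4` (transverse: the
transition functional `X ↦ B(g, X g')/N` is quasi-free with two-point function `G/N`; degenerate:
both sides vanish). TRUE (Chevalley III; Bravyi 2005 §3–4; Dias–Koenig 2024 §2.4–2.5; kit j008520 Q2,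
j010601 C0; numerics of this seat: kit j010918/j010921 tests T0, T3). Size L (Wick's theorem for
transition amplitudes from the annihilator definition `IsGaussian`). Honours Disproof §1 (full
Lagrangian annihilators), §4(6b) (`G ∈ Λ²ℂ¹⁶` carries both chiralities). -/
theorem stub_pairStructure :
    ∀ g g' : QReg (2 * 4) → ℂ, IsGaussian g → IsGaussian g' →
      bilin g' g = bilin g g' ∧ pairCov g' g = -pairCov g g' ∧ (pairCov g g')ᵀ = -pairCov g g' ∧
      pairCov g g' * pairCov g g' = (bilin g g') ^ 2 • (1 : Matrix (Fin 16) (Fin 16) ℂ) ∧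
      ∀ S : Finset (Fin 16), S.card = 4 → bilin g g' * cov g g' S = pf4 (pairCov g g') S := by
  sorry

/-- **STUB 3 — TRIPLE STRUCTURE (the three pair involutions come from ONE Lagrangian triple).**
For three pairwise `B`-transverse Gaussian states, `J_{ij} := pairCov gᵢ gⱼ / B(gᵢ,gⱼ)` is the
reflection `π_{Lᵢ} − π_{Lⱼ}` (`+1` on the annihilator Lagrangian `Lᵢ` of the LEFT argument, `−1` on
`Lⱼ`), so the three involutions share eigenspaces: `Lᵢ = E₊(J_{ij}) = E₊(J_{ik})`, i.e. uniformly
`(J_{ij} − 1)(J_{ik} + 1) = 0` for all ordered triples of distinct indices (with `J_{ji} = −J_{ij}`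
this encodes all six sharings), here multiplied through by the nonzero scalars `N_{ij} N_{ik}`.
TRUE (same derivation as the involution law of stub 2: `ω(c(x)c(y)) = 2x_{L'}·y_L = x·Jy`; kit
j011147 of this seat checks orientation and the relation numerically). Size M given stub 2's
infrastructure. This is the PROVENANCE constraint that makes stub 6 exactly the card's honest `C⁺`
("relative covariances of ONE triple of Lagrangian 8-planes", 84 parameters instead of 3 × 56). -/
theorem stub_tripleStructure :
    ∀ g : Fin 3 → QReg (2 * 4) → ℂ, (∀ i, IsGaussian (g i)) →
      (∀ i j : Fin 3, i ≠ j → bilin (g i) (g j) ≠ 0) →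
      ∀ i j k : Fin 3, i ≠ j → i ≠ k → j ≠ k →
        (pairCov (g i) (g j) - bilin (g i) (g j) • (1 : Matrix (Fin 16) (Fin 16) ℂ)) *
          (pairCov (g i) (g k) + bilin (g i) (g k) • (1 : Matrix (Fin 16) (Fin 16) ℂ)) = 0 := by
  sorry

/-- **STUB 4 — ISOTROPIC PAIRS ARE FREE (shared with line `lagrangian-triple-rigidity`, Case D).**
No 3-term Gaussian decomposition of `M⊗M` in which two terms are `B`-orthogonal. By Chevalley
(`B(u_L,u_{L'}) = 0 ⇔ L ∩ L' ≠ 0`, incl. proportional terms and opposite parities) such a pair shares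
a nonzero annihilator `d`; with `D = Lᵢ ∩ Lⱼ` (`dim d ∈ {2,4,6}`, or the ≤ 2-term sub-cases) the
bivectors `D ∧ (L_k ∩ D^⊥)` give `d(8−d) ≥ 12` independent pairwise-annihilating quadratic operators
killing all three terms, hence stabilising `M⊗M`, whose stabiliser is `spin(7)_A ⊕ spin(7)_B`
block-diagonal with ≤ 5 such operators per block (Lemma C) — contradiction (Ideator3Notes §6.2–6.4;
`PairProductAnnihilates` is already kernel-checked in `Ideator3Sketch.lean`; re-derived by all three
triagers, kit j009858 / j010601 / j010554). TRUE on paper. Size M–L (shares the vacuum-uniqueness /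
`AnnihilatorIsLagrangian` infrastructure with the sibling line). This line's own mechanism needs
`N_{ij} ≠ 0` (step 4), so the degenerate strata are delegated here by design. -/
theorem stub_isotropicPairFree :
    ∀ (a : Fin 3 → ℂ) (g : Fin 3 → QReg (2 * 4) → ℂ), (∀ i, IsGaussian (g i)) →
      (∃ i j : Fin 3, i ≠ j ∧ bilin (g i) (g j) = 0) → magicMPow 2 ≠ ∑ i, a i • g i := by
  sorry

/-- **STUB 5 — THE TARGET IS THE DOUBLE CAYLEY FORM (finite computation).** For `v = M⊗M`
(`magicMPow 2`, amplitude `1/2` on the four block-constant strings): `β₀(v,v) = B(v,v) = 1`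
(`Cv = v`) and, for every 4-subset `S` of the Majorana labels, `β₄(v,v)_S = B(v, c_S v) = ⟨v|c_S|v⟩`
equals `cayleyTable S`: `+1` on `XXXX`, `YYYY` of each block, `−1` on the other twelve in-block
Hamming quadruples, `0` on the 1792 remaining quadruples (all mixed ones included). TRUE: exact
finite computation over `ℚ(i)` (amplitudes `1/2`, Pauli-string entries `±1, ±i`); computed in
exactly these conventions by this seat's kit j010918 (T1: 14 + 14 + 0, values ±1) and before by kit
j008520 Q3–Q4 / j010601 Q4. Size M (a `decide`-style evaluation over a computable model of
`pauliString`, or 28 + "support" lemmas). Why a stub and not glue: it is the entire information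
about `M` that step 6 consumes (the Cayley/Hamming rigidity), and it is checkable independently. -/
theorem stub_magicQuartic :
    cov (magicMPow 2) (magicMPow 2) ∅ = 1 ∧
      ∀ S : Finset (Fin 16), S.card = 4 → cov (magicMPow 2) (magicMPow 2) S = cayleyTable S := by
  sorry

/-- **STUB 6 — THREE LAGRANGIAN-PAIR SQUARES NEVER MAKE THE DOUBLE CAYLEY FORM (load-bearing,
OPEN).** There are no coefficients `a`, pair scalars `N_{ij} ≠ 0` (symmetric), pair matrices
`G_{ij} ∈ ℂ^{16×16}` (skew in `(x,y)` and in `(i,j)`, INVOLUTIONS up to scale: `G_{ij}² = N_{ij}²·1`)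
and pair quartics `Q_{ij}` tied to them by Wick (`N_{ij} Q_{ij}(S) = Pf(G_{ij}[S])`) such that the
degree-0 and degree-4 pair sums reproduce the covariants of `v = M⊗M`:
`Σ_{i≠j} aᵢaⱼN_{ij} = 1` (`= β₀(v,v)`) and `Σ_{i≠j} aᵢaⱼQ_{ij}(S) = cayleyTable S` (`= β₄(v,v)_S`, stub 4)
for all `|S| = 4`. The right-hand side is the DOUBLE CAYLEY 4-FORM `Φ_A ⊕ Φ_B` (fully explicit): `±1` on the
14 + 14 in-block Hamming quadruples (the degree-4 stabilisers of each GHZ₄ block), `0` on every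
mixed quadruple, stabiliser `spin(7) ⊕ spin(7)` (kit j008520 Q3–Q4, j010601 Q4; re-computed by
this seat's kit j010918/j010921 T1). In 2-form language (`J_p = G_p/N_p`, `t_p = 2aᵢaⱼN_p`):
no three skew involutions `J_p` of `(ℂ¹⁶,·)` and weights with `Σ t_p = 1`, `Σ_p t_p (J_p∧J_p)/2 =
Φ_A ⊕ Φ_B`. This is the card's Transfer `C⁺` stated HONESTLY (triage r1-2 (a)): strictly stronger
than the crux (it drops `β₈`), weaker than the free three-squares problem (involution + trace
constraints kept; the provenance "one Lagrangian TRIPLE" is deliberately NOT kept — add it as a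
hypothesis if this version dies). Attack (triage r1-3): block-decompose `J_p = A_p + C_p + B_p`;
`(4,0)`: `Σ t_pA_p∧A_p = Φ_A` has ∧-rank exactly 3 ⇒ `A_p` independent, all `t_p ≠ 0`; `(3,1)`+`(1,3)`:
`Σ_p t_p A_p ∧ C_p(y) = 0` ⇒ `C ≡ 0` once the net map `(w_p) ↦ Σ A_p∧w_p` is injective
(NET INJECTIVITY — verified by hand for the standard Cayley net `{ω, G, Ḡ}`, open for the other
3-square representations); then `(2,2)`: `Σ t_p A_p ⊗ B_p = 0` ⇒ `B_p = 0` ⇒ `Φ_B = 0`, absurd.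
Why it might fail: a non-standard 3-square representation of `Φ_A` with a non-injective net and
compatible cross blocks (representation variety has dim ≥ 14 > 9); cheapest falsifier = kit
j010921 Parts C/D/E of this seat (honest `C⁺` least squares in spinor form; free three-squares;
net-injectivity sampling) and triage-3's kit j010555. Size L. -/
theorem stub_threeSquaresFree :
    ∀ (a : Fin 3 → ℂ) (Nn : Fin 3 → Fin 3 → ℂ) (G : Fin 3 → Fin 3 → Matrix (Fin 16) (Fin 16) ℂ)
      (Q : Fin 3 → Fin 3 → Finset (Fin 16) → ℂ),
      (∀ i j : Fin 3, i ≠ j →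
        Nn i j ≠ 0 ∧ Nn j i = Nn i j ∧ G j i = -G i j ∧ (G i j)ᵀ = -G i j ∧
        G i j * G i j = (Nn i j) ^ 2 • (1 : Matrix (Fin 16) (Fin 16) ℂ) ∧
        ∀ S : Finset (Fin 16), S.card = 4 → Nn i j * Q i j S = pf4 (G i j) S) →
      (∀ i j k : Fin 3, i ≠ j → i ≠ k → j ≠ k →
        (G i j - Nn i j • (1 : Matrix (Fin 16) (Fin 16) ℂ)) *
          (G i k + Nn i k • (1 : Matrix (Fin 16) (Fin 16) ℂ)) = 0) →
      (∑ i, ∑ j, if i = j then 0 else a i * a j * Nn i j) = 1 →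
      (∀ S : Finset (Fin 16), S.card = 4 →
        (∑ i, ∑ j, if i = j then 0 else a i * a j * Q i j S) = cayleyTable S) →
      False := by
  sorry

/-! ## Kernel-checked composition -/

/-- **COMPOSITION LEMMA (proved, no `sorry` of its own).** The six stub STATEMENTS, taken as hypotheses,
imply the named form of the crux `∀ a g, (∀ i, IsGaussian (g i)) → magicMPow 2 ≠ Σ aᵢ • gᵢ`: given a
putative decomposition, either some pair is `B`-orthogonal (hypothesis 4 kills it), or all `N_{ij} ≠ 0`;
then prolongation (1) turns the decomposition into the six-pair-term identities in degrees 0 and 4, the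
pair and triple structure (2, 3) supply the Wick/involution/sharing data, the target computation (5)
makes the right-hand sides explicit, and (6) says such data cannot reproduce the double Cayley form. -/
theorem twoCopies_of_stubs
    (h1 : ∀ (a : Fin 3 → ℂ) (g : Fin 3 → QReg (2 * 4) → ℂ), (∀ i, IsGaussian (g i)) →
      ∀ S : Finset (Fin 16), S.card < 8 →
        cov (∑ i, a i • g i) (∑ i, a i • g i) S =
          ∑ i, ∑ j, if i = j then 0 else a i * a j * cov (g i) (g j) S)
    (h2 : ∀ g g' : QReg (2 * 4) → ℂ, IsGaussian g → IsGaussian g' →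
      bilin g' g = bilin g g' ∧ pairCov g' g = -pairCov g g' ∧ (pairCov g g')ᵀ = -pairCov g g' ∧
      pairCov g g' * pairCov g g' = (bilin g g') ^ 2 • (1 : Matrix (Fin 16) (Fin 16) ℂ) ∧
      ∀ S : Finset (Fin 16), S.card = 4 → bilin g g' * cov g g' S = pf4 (pairCov g g') S)
    (h3 : ∀ g : Fin 3 → QReg (2 * 4) → ℂ, (∀ i, IsGaussian (g i)) →
      (∀ i j : Fin 3, i ≠ j → bilin (g i) (g j) ≠ 0) →
      ∀ i j k : Fin 3, i ≠ j → i ≠ k → j ≠ k →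
        (pairCov (g i) (g j) - bilin (g i) (g j) • (1 : Matrix (Fin 16) (Fin 16) ℂ)) *
          (pairCov (g i) (g k) + bilin (g i) (g k) • (1 : Matrix (Fin 16) (Fin 16) ℂ)) = 0)
    (h4 : ∀ (a : Fin 3 → ℂ) (g : Fin 3 → QReg (2 * 4) → ℂ), (∀ i, IsGaussian (g i)) →
      (∃ i j : Fin 3, i ≠ j ∧ bilin (g i) (g j) = 0) → magicMPow 2 ≠ ∑ i, a i • g i)
    (h5 : cov (magicMPow 2) (magicMPow 2) ∅ = 1 ∧
      ∀ S : Finset (Fin 16), S.card = 4 → cov (magicMPow 2) (magicMPow 2) S = cayleyTable S)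
    (h6 : ∀ (a : Fin 3 → ℂ) (Nn : Fin 3 → Fin 3 → ℂ) (G : Fin 3 → Fin 3 → Matrix (Fin 16) (Fin 16) ℂ)
      (Q : Fin 3 → Fin 3 → Finset (Fin 16) → ℂ),
      (∀ i j : Fin 3, i ≠ j →
        Nn i j ≠ 0 ∧ Nn j i = Nn i j ∧ G j i = -G i j ∧ (G i j)ᵀ = -G i j ∧
        G i j * G i j = (Nn i j) ^ 2 • (1 : Matrix (Fin 16) (Fin 16) ℂ) ∧
        ∀ S : Finset (Fin 16), S.card = 4 → Nn i j * Q i j S = pf4 (G i j) S) →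
      (∀ i j k : Fin 3, i ≠ j → i ≠ k → j ≠ k →
        (G i j - Nn i j • (1 : Matrix (Fin 16) (Fin 16) ℂ)) *
          (G i k + Nn i k • (1 : Matrix (Fin 16) (Fin 16) ℂ)) = 0) →
      (∑ i, ∑ j, if i = j then 0 else a i * a j * Nn i j) = 1 →
      (∀ S : Finset (Fin 16), S.card = 4 →
        (∑ i, ∑ j, if i = j then 0 else a i * a j * Q i j S) = cayleyTable S) →
      False) :
    ∀ (a : Fin 3 → ℂ) (g : Fin 3 → QReg (2 * 4) → ℂ), (∀ i, IsGaussian (g i)) →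
      magicMPow 2 ≠ ∑ i, a i • g i := by
  intro a g hg heq
  by_cases hdeg : ∃ i j : Fin 3, i ≠ j ∧ bilin (g i) (g j) = 0
  · exact h4 a g hg hdeg heq
  · push Not at hdeg
    obtain ⟨hq0, hq4⟩ := h5
    refine h6 a (fun i j => bilin (g i) (g j)) (fun i j => pairCov (g i) (g j))
      (fun i j S => cov (g i) (g j) S) ?_ ?_ ?_ ?_
    · intro i j hij
      obtain ⟨hsym, hskew, htr, hsq, hwick⟩ := h2 (g i) (g j) (hg i) (hg j)
      exact ⟨hdeg i j hij, hsym, hskew, htr, hsq, hwick⟩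
    · intro i j k hij hik hjk
      exact h3 g hg hdeg i j k hij hik hjk
    · have h := h1 a g hg ∅ (by simp)
      rw [← heq, hq0] at h
      simp only [cov_empty] at h
      exact h.symm
    · intro S hS
      have h := h1 a g hg S (by omega)
      rw [← heq, hq4 S hS] at h
      exact h.symm

/-- **THE SKELETON THEOREM: the six registered stubs prove the crux `GaussRankTwoCopies` BY NAME.**
The route decl unfolds (three `let`s, `Iff.rfl`-identical to the named API: Disproof §0 `crux_iff`)
to the conclusion of `twoCopies_of_stubs`; the only gaps the audit sees are the six `sorry`s of the
stubs, each used here by name. -/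
theorem GaussRankTwoCopies_of :
    Summit.QuantumAdvantage.QuantumAdvantage.Theses.SpinorFlattening.GaussRankTwoCopies := by
  intro a g hg
  exact twoCopies_of_stubs stub_prolongation stub_pairStructure stub_tripleStructure
    stub_isotropicPairFree stub_magicQuartic stub_threeSquaresFree a g hg

/-- The landed Negative lemma is in scope (Disproof §2 / p74629): four terms DO reach `M⊗M`, so
the stubs above are deliberately about three terms / pairs only. -/
example := @Summit.QuantumAdvantage.QuantumAdvantage.Theorems.GaussRankTwoCopies.Negative.gaussRankTwoCopies_tight_four

end Summit.QuantumAdvantage.QuantumAdvantage.Cruxes.GaussRankTwoCopies.CayleyBilinearProlongation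

end
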